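import Literature.AlgebraicGeometry.Frobenioids.BaseCategoryTheoreticity
import Literature.AlgebraicGeometry.Frobenioids.GroupLikeStandardExampleFrobenioid
import Literature.AlgebraicGeometry.Frobenioids.GroupLikeStandardExampleProofs
import HarnessLib

/-!
# Frobenioids I, §3: Example 3.6 in the typed vocabulary of Theorem 3.4 — hypothesis (b) `HypB`
# is NOT implied by hypotheses (a), (c) (FACT-LIST F-0893; also F-0895)

Mochizuki, *The geometry of Frobenioids I: the general theory*, Kyushu J. Math. **62** (2008) 293–400,
kurims text, Thm. 3.4 pp. 62–63 and Ex. 3.6 p. 70 [cite: MochizukiFrdI2008, Ex. 3.6 p.70]: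
"(ii) Frobenioids of standard and group-like type: … Then the equivalence of categories `Ψ : C → C`
determined by the automorphism of monoids `F_G × F_G ⥲ F_G × F_G` given by switching the two factors
clearly fails to preserve base-isomorphisms [cf. Theorem 3.4, (iii)]" — print's illustration that
hypothesis (b) of Thm. 3.4 (iii)–(v) ("if `C₁, C₂` are of group-like type, then both `Ψ` and some
quasi-inverse to `Ψ` preserve base-isomorphisms") cannot be dropped.

PROOF-ONLY companion (no definition, no instance; the switching self-equivalence is built inside the
proofs) of `BaseCategoryTheoreticity.lean` (abc-iut-L1-t3: the typed `PreFrobenioidData.HypB`,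
`PreservesDegFr`, `Thm34iii/iv/v`) and of abc-iut-L1-t8's Example 3.6 files
(`GroupLikeStandardExample*.lean`: the data `Ex36.Φ` = `G := ℤ ⊕ ⨁_p ℤ/pℤ` with trivial action on the
one-object category `D` of `F_G`, `Ex36.identification : End ≃* F_G × F_G`, `Ex36.isFrobenioid`,
`Ex36.isOfStandardType`, `Ex36.dSlim_holds`, `Ex36.isOfFSMType`; there the factor switch is recorded on
the MODEL category `SingleObj (F_G × F_G)` as `Ex36.swap_not_preserves_baseIso`). Written by the abc-iut
cell seat abc-iut-f-017 (F fact-proving wave, FACT-LIST row F-0893 `PreFrobenioidData.HypB`).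

What is proved here, for the ACTUAL Frobenioid `C = F_Φ` of Ex. 3.6 (the category `ElemFrobenioid Ex36.Φ`
with its pre-Frobenioid structure `ElemFrobenioid.toChar Ex36.Φ : F_Φ → F_{Φ^char}`, operations
`S := PreFrobenioidData.ofFunctor (charFunctor Ex36.Φ) (ElemFrobenioid.toChar Ex36.Φ)`):

* `Ex36.exists_switchingEquivalence` — the factor switch `(b, (z, n)) ↦ ((z, n), b)` IS a
  self-equivalence `Ψ` of `F_Φ` (an involution; kernel form of print's "equivalence of categories
  determined by … switching the two factors"), with its action on `Base`, `Div`, `deg_Fr` recorded;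
* `Ex36.isOfGroupLikeType` — `C` is of group-like type in the typed sense (so (b) is NOT vacuous here);
  `Ex36.isFrobeniusSlim` — `D` is Frobenius-slim (it is slim, `Ex36.dSlim_holds`), i.e. hypothesis (c)
  of Thm. 3.4 (iv) and (v) holds as well, and (a) is `Ex36.isOfStandardType`;
* the CONCLUSIONS of Thm. 3.4 (iii), (iv), (v) FAIL for `Ψ`: it does not preserve base-isomorphisms
  (`exists_equivalence_not_preservesMor_isBaseIso` — print's sentence), linear morphisms
  (`…_isLinear`), Frobenius degrees (`exists_equivalence_not_preservesDegFr`, the typed `PreservesDegFr`,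
  row F-0895) or base-identity endomorphisms (`exists_equivalence_not_preserves_isBaseIdentity`, (v));
* hence (b) FAILS: `Ex36.exists_equivalence_not_hypB`, and the closed forms
  `not_forall_hypB_of_isOfStandardType` / `not_forall_preservesDegFr_of_isOfStandardType`: over
  GENUINE Frobenioids of standard type on a slim base of FSM-type, neither hypothesis (b) nor the
  conclusion "`Ψ` preserves Frobenius degrees" holds for every self-equivalence — so (b) is a
  load-bearing hypothesis of the discharged named facts `FrdI.Thm34iii_holds` / `Thm34iv_holds` /
  `Thm34v_holds` (F-0712/0713/0714), exactly as print says, and the F-0893 / F-0895 closures are refuted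
  at a Frobenioid of print (the earlier witnesses in `BaseCategoryTheoreticitySchemaNegative.lean` were
  the non-Frobenioid group-like reading of Ex. 3.5, resp. Ex. 3.5 itself, which is not of standard type).

Classical bookkeeping about [FrdI] §3; no statement of the paper is strengthened or asserted false;
nothing here bears on [IUTchIII] Cor. 3.12 or takes a side.
-/

namespace Literature.AlgebraicGeometry.Frobenioids

open CategoryTheory Opposite

namespace Ex36

/-- **Example 3.6, "… and group-like type"** in the typed sense of Def. 1.2 (v) for the operations
`(Base, Div, deg_Fr)` of `C = F_Φ → F_{Φ^char}`: every object is group-like (`Φ^char(A) = G/G^× = 0`).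
[cite: MochizukiFrdI2008, Ex. 3.6 p.70] -/
theorem isOfGroupLikeType :
    (PreFrobenioidData.ofFunctor (charFunctor Φ) (ElemFrobenioid.toChar Φ)).IsOfGroupLikeType :=
  ⟨fun A =>
    (PreFrobenioidData.ofFunctor_isGroupLikeObj (ElemFrobenioid.toChar Φ) A).mpr (isOfType_isGroupLikeObj A)⟩

/-- **Example 3.6**: the base category `D` (one object, `End = F_G`) is Frobenius-slim — "[every slim
category is Frobenius-slim]" (Def. 3.1 (i) p. 56) and "`D` is slim" (p. 70, `Ex36.dSlim_holds`). So
hypothesis (c) of Thm. 3.4 (iv) holds for `C`. [cite: MochizukiFrdI2008, Ex. 3.6 p.70] -/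
theorem isFrobeniusSlim : IsFrobeniusSlim Literature.AlgebraicGeometry.Frobenioids.Ex36.D :=
  dSlim_holds.isFrobeniusSlim

/-- **Example 3.6, the switching self-equivalence of `C = F_Φ`** ("the equivalence of categories
`Ψ : C → C` determined by the automorphism of monoids `F_G × F_G ⥲ F_G × F_G` given by switching the two
factors", p. 70), realised on the ACTUAL category `ElemFrobenioid Ex36.Φ` (one object up to equality;
arrows `(b, z, n)` with `b ∈ F_G = End_D`, `(z, n) ∈ G × N_{≥1} = F_G`, cf. `Ex36.identification`): there
is a self-equivalence `Ψ`, equal to its own chosen quasi-inverse, with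
`Base(Ψ(φ)) = (Div(φ), deg_Fr(φ))`, `deg_Fr(Ψ(φ)) = deg_Fr(Base(φ))`, `Div(Ψ(φ)) = Div-part of Base(φ)`.
(Functoriality holds because all pull-backs of `Φ` are identities and `N_{≥1}` is commutative.)
[cite: MochizukiFrdI2008, Ex. 3.6 p.70] -/
theorem exists_switchingEquivalence :
    ∃ Ψ : ElemFrobenioid Φ ≌ ElemFrobenioid Φ, Ψ.inverse = Ψ.functor ∧
      ∀ ⦃A B : ElemFrobenioid Φ⦄ (φ : A ⟶ B),
        (show FG from ElemFrobenioid.Base (Ψ.functor.map φ)) =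
            ⟨ElemFrobenioid.Div φ, ElemFrobenioid.degFr φ⟩ ∧
          ElemFrobenioid.degFr (Ψ.functor.map φ) = (show FG from ElemFrobenioid.Base φ).degFr ∧
          ElemFrobenioid.Div (Ψ.functor.map φ) = (show FG from ElemFrobenioid.Base φ).div := by
  -- the factor switch `(b, (z, n)) ↦ ((z, n), b)` as an endofunctor of `F_Φ`
  let Ψ₀ : ElemFrobenioid Φ ⥤ ElemFrobenioid Φ :=
    { obj := fun A => A
      map := fun {A B} φ => ElemFrobenioid.homMk
        (show A.base ⟶ B.base from (⟨ElemFrobenioid.Div φ, ElemFrobenioid.degFr φ⟩ : FG))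
        (show FG from ElemFrobenioid.Base φ).div (show FG from ElemFrobenioid.Base φ).degFr
      map_id := fun _ => rfl
      map_comp := fun φ ψ => by
        refine ElemFrobenioid.Hom.ext ?_ ?_ ?_
        · exact ElemFrobenioidMonoid.ext rfl (mul_comm _ _)
        · rfl
        · exact mul_comm _ _ }
  -- `Ψ₀ ∘ Ψ₀ = id` on the nose, so the identity transformations exhibit `Ψ₀` as its own quasi-inverse
  have hΨ₀ : Ψ₀ ⋙ Ψ₀ = 𝟭 (ElemFrobenioid Φ) := rfl
  refine ⟨{ functor := Ψ₀, inverse := Ψ₀, unitIso := Iso.refl _, counitIso := Iso.refl _,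
            functor_unitIso_comp := fun X => ?_ }, rfl, fun A B φ => ⟨rfl, rfl, rfl⟩⟩
  exact (Category.comp_id _).trans (Ψ₀.map_id X)

/-- **Example 3.6: "[the switching equivalence] clearly fails to preserve base-isomorphisms
[cf. Theorem 3.4, (iii)]"** (p. 70) — for the ACTUAL `F_Φ` and the typed class `IsBaseIso` of Def. 1.2
(ii): the base-isomorphism `(id, 0, 2)` of the unique object is sent to an arrow whose base `(0, 2) ∈ F_G`
has Frobenius degree `2`, hence is not invertible. So the conclusion "`Ψ` preserves base-isomorphisms" of
Thm. 3.4 (iii) fails here. [cite: MochizukiFrdI2008, Ex. 3.6 p.70] -/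
theorem exists_equivalence_not_preservesMor_isBaseIso :
    ∃ Ψ : ElemFrobenioid Φ ≌ ElemFrobenioid Φ, Ψ.inverse = Ψ.functor ∧
      ¬ PreFrobenioidData.PreservesMor Ψ.functor
          (PreFrobenioidData.ofFunctor (charFunctor Φ) (ElemFrobenioid.toChar Φ)).IsBaseIso
          (PreFrobenioidData.ofFunctor (charFunctor Φ) (ElemFrobenioid.toChar Φ)).IsBaseIso := by
  obtain ⟨Ψ, hinv, hΨ⟩ := exists_switchingEquivalence
  refine ⟨Ψ, hinv, fun h => ?_⟩
  -- the base-isomorphism `(id, 0, 2)` of the unique object `A_G` of `F_Φ`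
  let φ₀ : trivObj FG (Multiplicative G) ⟶ trivObj FG (Multiplicative G) :=
    ElemFrobenioid.homMk (𝟙 _) 1 2
  have h0 : (PreFrobenioidData.ofFunctor (charFunctor Φ) (ElemFrobenioid.toChar Φ)).IsBaseIso φ₀ :=
    (isIso_iff_degFr_eq_one _).mpr rfl
  have h1 : (show FG from ElemFrobenioid.Base (Ψ.functor.map φ₀)).degFr = 1 :=
    (isIso_iff_degFr_eq_one _).mp (h φ₀ h0)
  have h2 : (2 : ℕ+) = 1 := (congrArg ElemFrobenioidMonoid.degFr (hΨ φ₀).1).symm.trans h1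
  exact absurd (congrArg PNat.val h2) (by decide)

/-- **Hypothesis (b) `HypB` of Thm. 3.4 (iii)–(v) FAILS at Example 3.6** (typed form of print's
"[cf. Theorem 3.4, (iii)]", p. 70): `C = F_Φ` is of group-like type (`Ex36.isOfGroupLikeType`) and the
switching self-equivalence does not preserve base-isomorphisms, so `HypB S S Ψ` is false — although
hypothesis (a) "`C` of standard type" (`Ex36.isOfStandardType`) and (c) "`D` slim" (`Ex36.dSlim_holds`)
hold. FACT-LIST F-0893 at a GENUINE Frobenioid of print. [cite: MochizukiFrdI2008, Ex. 3.6 p.70] -/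
theorem exists_equivalence_not_hypB :
    ∃ Ψ : ElemFrobenioid Φ ≌ ElemFrobenioid Φ,
      ¬ (PreFrobenioidData.ofFunctor (charFunctor Φ) (ElemFrobenioid.toChar Φ)).HypB
          (PreFrobenioidData.ofFunctor (charFunctor Φ) (ElemFrobenioid.toChar Φ)) Ψ := by
  obtain ⟨Ψ, -, hΨ⟩ := exists_equivalence_not_preservesMor_isBaseIso
  exact ⟨Ψ, fun hB => hΨ (hB isOfGroupLikeType isOfGroupLikeType).1⟩

/-- **Example 3.6 vs the conclusion of Thm. 3.4 (iii) on linear morphisms**: the switching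
self-equivalence sends the linear arrow `((0, 2), 0, 1)` (base of Frobenius degree `2`, `deg_Fr = 1`) to
an arrow of Frobenius degree `2`; so "`Ψ` preserves linear morphisms" fails here too.
[cite: MochizukiFrdI2008, Ex. 3.6 p.70] -/
theorem exists_equivalence_not_preservesMor_isLinear :
    ∃ Ψ : ElemFrobenioid Φ ≌ ElemFrobenioid Φ, Ψ.inverse = Ψ.functor ∧
      ¬ PreFrobenioidData.PreservesMor Ψ.functor
          (PreFrobenioidData.ofFunctor (charFunctor Φ) (ElemFrobenioid.toChar Φ)).IsLinear
          (PreFrobenioidData.ofFunctor (charFunctor Φ) (ElemFrobenioid.toChar Φ)).IsLinear := by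
  obtain ⟨Ψ, hinv, hΨ⟩ := exists_switchingEquivalence
  refine ⟨Ψ, hinv, fun h => ?_⟩
  -- the linear arrow `((0, 2), 0, 1)` of the unique object
  let φ₁ : trivObj FG (Multiplicative G) ⟶ trivObj FG (Multiplicative G) :=
    ElemFrobenioid.homMk (show SingleObj.star FG ⟶ SingleObj.star FG from (⟨1, 2⟩ : FG)) 1 1
  have h0 : (PreFrobenioidData.ofFunctor (charFunctor Φ) (ElemFrobenioid.toChar Φ)).IsLinear φ₁ := rfl
  have h1 : ElemFrobenioid.degFr (Ψ.functor.map φ₁) = 1 := h φ₁ h0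
  have h2 : (2 : ℕ+) = 1 := (hΨ φ₁).2.1.symm.trans h1
  exact absurd (congrArg PNat.val h2) (by decide)

/-- **Example 3.6 vs "`Ψ` preserves Frobenius degrees" / "`Ψ^{N_{≥1}}` is the identity"** (conclusion
of Thm. 3.4 (iii) second part and of (iv); the typed `PreservesDegFr`, FACT-LIST F-0895): the switching
self-equivalence changes the Frobenius degree of `((0, 2), 0, 1)` from `1` to `2`. Here (a) and (c)
(`D` slim, hence Frobenius-slim) hold and (b) fails — consistent with Thm. 3.4 and showing that (b)
carries weight in (iv). [cite: MochizukiFrdI2008, Ex. 3.6 p.70] -/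
theorem exists_equivalence_not_preservesDegFr :
    ∃ Ψ : ElemFrobenioid Φ ≌ ElemFrobenioid Φ, Ψ.inverse = Ψ.functor ∧
      ¬ (PreFrobenioidData.ofFunctor (charFunctor Φ) (ElemFrobenioid.toChar Φ)).PreservesDegFr
          (PreFrobenioidData.ofFunctor (charFunctor Φ) (ElemFrobenioid.toChar Φ)) Ψ := by
  obtain ⟨Ψ, hinv, hΨ⟩ := exists_switchingEquivalence
  refine ⟨Ψ, hinv, fun h => ?_⟩
  let φ₁ : trivObj FG (Multiplicative G) ⟶ trivObj FG (Multiplicative G) :=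
    ElemFrobenioid.homMk (show SingleObj.star FG ⟶ SingleObj.star FG from (⟨1, 2⟩ : FG)) 1 1
  have h1 : ElemFrobenioid.degFr (Ψ.functor.map φ₁) = ElemFrobenioid.degFr φ₁ := h φ₁
  have h2 : (2 : ℕ+) = 1 := (hΨ φ₁).2.1.symm.trans h1
  exact absurd (congrArg PNat.val h2) (by decide)

/-- **Example 3.6 vs the conclusion of Thm. 3.4 (v)** ("`Ψ` preserves the base-identity endomorphisms",
stated under (a), (b), (c) `D₁, D₂` slim): at `C = F_Φ` of Ex. 3.6, where (a) and (c) hold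
(`Ex36.isOfStandardType`, `Ex36.dSlim_holds`) but (b) fails, the switching self-equivalence sends the
base-identity endomorphism `(id, 0, 2)` to an endomorphism with base `(0, 2) ≠ id`. So (b) carries weight
in (v) as well. [cite: MochizukiFrdI2008, Ex. 3.6 p.70] -/
theorem exists_equivalence_not_preserves_isBaseIdentity :
    ∃ Ψ : ElemFrobenioid Φ ≌ ElemFrobenioid Φ, Ψ.inverse = Ψ.functor ∧
      ¬ ∀ (A : ElemFrobenioid Φ) (α : A ⟶ A),
          (PreFrobenioidData.ofFunctor (charFunctor Φ) (ElemFrobenioid.toChar Φ)).IsBaseIdentity α →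
          (PreFrobenioidData.ofFunctor (charFunctor Φ) (ElemFrobenioid.toChar Φ)).IsBaseIdentity
            (Ψ.functor.map α) := by
  obtain ⟨Ψ, hinv, hΨ⟩ := exists_switchingEquivalence
  refine ⟨Ψ, hinv, fun h => ?_⟩
  let φ₀ : trivObj FG (Multiplicative G) ⟶ trivObj FG (Multiplicative G) :=
    ElemFrobenioid.homMk (𝟙 _) 1 2
  have h0 : (PreFrobenioidData.ofFunctor (charFunctor Φ) (ElemFrobenioid.toChar Φ)).IsBaseIdentity φ₀ :=
    rfl
  have h1 : (show FG from ElemFrobenioid.Base (Ψ.functor.map φ₀)) = 1 := h _ φ₀ h0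
  have h2 : (2 : ℕ+) = 1 := congrArg ElemFrobenioidMonoid.degFr ((hΨ φ₀).1.symm.trans h1)
  exact absurd (congrArg PNat.val h2) (by decide)

end Ex36

/-! ## Closed forms: (a) + (c) do not give (b), nor the degree conclusion, over genuine Frobenioids -/

/-- **FACT-LIST F-0893 at genuine Frobenioids**: it is NOT the case that for every Frobenioid
`C → F_Φ` of standard type over a slim base category of FSM-type and every self-equivalence `Ψ`,
hypothesis (b) `HypB` of Thm. 3.4 (iii)–(v) holds — witness print's Example 3.6 with its switching
self-equivalence (`Ex36.exists_equivalence_not_hypB`). So (b) is independent of (a) and (c), as the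
paper illustrates on p. 70; it is consumed as a binder by the Thm. 3.4 / Cor. 4.11 / 4.12 closers.
[cite: MochizukiFrdI2008, Ex. 3.6 p.70] -/
theorem not_forall_hypB_of_isOfStandardType :
    ¬ ∀ (D : Type) [SmallCategory D] (Φ : Dᵒᵖ ⥤ CommMonCat.{0}) (C : Type) [SmallCategory C]
        (F : C ⥤ ElemFrobenioid Φ) (Ψ : C ≌ C),
        PreFrobenioid.IsFrobenioid F → (PreFrobenioidData.ofFunctor Φ F).IsOfStandardType →
          IsSlim D → IsOfFSMType D →
            (PreFrobenioidData.ofFunctor Φ F).HypB (PreFrobenioidData.ofFunctor Φ F) Ψ := by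
  intro h
  obtain ⟨Ψ, hΨ⟩ := Ex36.exists_equivalence_not_hypB
  exact hΨ (h Ex36.D (charFunctor Ex36.Φ) (ElemFrobenioid Ex36.Φ) (ElemFrobenioid.toChar Ex36.Φ) Ψ
    Ex36.isFrobenioid Ex36.isOfStandardType Ex36.dSlim_holds Ex36.isOfFSMType)

/-- **FACT-LIST F-0895 at genuine Frobenioids of standard type**: it is NOT the case that every
self-equivalence of a Frobenioid of standard type over a slim base of FSM-type preserves Frobenius
degrees (the typed `PreservesDegFr`, conclusion of Thm. 3.4 (iii)/(iv)) — witness Example 3.6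
(`Ex36.exists_equivalence_not_preservesDegFr`), where exactly hypothesis (b) fails. The instance forms
under (a), (b), (c) are the Thm. 3.4 closers (`FrdI.Thm34iv_holds`, `FrdI.preservesDegFr_of_thm34ii_thm34iii`).
[cite: MochizukiFrdI2008, Thm. 3.4 (iv) p.63] -/
theorem not_forall_preservesDegFr_of_isOfStandardType :
    ¬ ∀ (D : Type) [SmallCategory D] (Φ : Dᵒᵖ ⥤ CommMonCat.{0}) (C : Type) [SmallCategory C]
        (F : C ⥤ ElemFrobenioid Φ) (Ψ : C ≌ C),
        PreFrobenioid.IsFrobenioid F → (PreFrobenioidData.ofFunctor Φ F).IsOfStandardType →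
          IsSlim D → IsOfFSMType D →
            (PreFrobenioidData.ofFunctor Φ F).PreservesDegFr (PreFrobenioidData.ofFunctor Φ F) Ψ := by
  intro h
  obtain ⟨Ψ, -, hΨ⟩ := Ex36.exists_equivalence_not_preservesDegFr
  exact hΨ (h Ex36.D (charFunctor Ex36.Φ) (ElemFrobenioid Ex36.Φ) (ElemFrobenioid.toChar Ex36.Φ) Ψ
    Ex36.isFrobenioid Ex36.isOfStandardType Ex36.dSlim_holds Ex36.isOfFSMType)

end Literature.AlgebraicGeometry.Frobenioids
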